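import Literature.RepresentationTheory.ClassicalInvariants.ReflectionGroupHarmonics
import Literature.RepresentationTheory.ClassicalInvariants.WeylGroupTypeDBasicInvariants
import HarnessLib

/-!
# `W(F₄)`-invariants of low degree inside `ℝ[p₂, p₄, p₆, p₈]` (Humphreys § 3.7, Table 1, row F₄ — the upper bounds)

## Source

J. E. Humphreys, *Reflection Groups and Coxeter Groups* (Cambridge, 1990) [Humphreys1990], § 2.10 (F₄: the
reflection in the short root `½(ε₁+ε₂+ε₃+ε₄)`), § 3.7 Table 1 «F₄ | 2, 6, 8, 12», read as: `dim ℝ[x]^{W(F₄)}_a`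
equals the number of ways of writing `a` as a sum of the degrees, so `dim = 1, 0, 1, 0, 2, …, 3` in degrees
`2, 3, 4, 5, 6, …, 10`. Basic invariants of `W(B₄)` are the even power sums `p₂, p₄, p₆, p₈` (Goodman–Wallach,
GTM 255, Exercises 5.1.3 #5 = the tree's `HyperoctahedralBasicInvariants`).

## What is here (the elementary half of the degree computation; no group theory)

A `W(F₄)`-invariant is in particular `W(B₄)`-invariant, i.e. a polynomial in `p₂, p₄, p₆, p₈`; a homogeneous one of
degree `a` is an isobaric polynomial of weight `a` in them (`SymmetricPolynomialsHilbertSeries`). Imposing invariance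
under the extra reflection `s : xⱼ ↦ xⱼ − ½ Σᵢ xᵢ` at one, one, resp. three rational test points cuts the spaces of
weight `4`, `6`, `10` down to explicit spans of `1`, `2`, `3` polynomials:

* § 1 the weights: `Finsupp.weight (2,4,6,8) β` in coordinates, the solutions of weight `4`, `6`, `10`, evenness;
* § 2 homogeneous elements of `ℝ[p₂, p₄, p₆, p₈]` of degree `4`, `6`, `10` lie in the span of the corresponding
  monomials (`mem_span_weight_four/six/ten`), and there are none of odd degree (`eq_zero_of_odd`);
* § 3 the values of `p₂, p₄, p₆, p₈` at the test points `(1,0,0,0)`, `(1,1,1,0)`, `(2,1,0,0)` and at their images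
  under `s`;
* § 4 **the cut**: a symmetric, flip-invariant, `s`-invariant homogeneous polynomial of degree `4` is a multiple of
  `p₂²` (`mem_span_of_invariant_four` — «no anisotropic invariant of degree 4»), of degree `6` lies in
  `span{p₂³, 5p₂p₄ − 4p₆}` (`…_six`), of degree `10` lies in a span of three explicit polynomials (`…_ten`); so the
  dimensions are `≤ 1, ≤ 2, ≤ 3` (`finrank_…_le`). `p₂` itself is `s`-invariant (`aeval_halfSum_psum_two`).

These bounds, with `|W(F₄)| ≤ 1152`, pin the degrees `2, 6, 8, 12` downstream. Theorems only (one abbreviation-free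
family `evenPsum`); no instances, no notation, no named facts.
-/

open MvPolynomial
open scoped BigOperators

namespace Literature.RepresentationTheory.ClassicalInvariants.WeylGroupF4

open Literature.RepresentationTheory.ClassicalInvariants.SymmetricPolynomialsHilbertSeries
  (exists_isWeightedHomogeneous_aeval_eq)
open Literature.RepresentationTheory.ClassicalInvariants.HyperoctahedralBasicInvariants
  (mem_adjoin_psum_even_of_isSymmetric_of_forall_aeval_flip_eq)
open Literature.RepresentationTheory.ClassicalInvariants.WeylGroupTypeDBasicInvariants (psum_isHomogeneous)

noncomputable section

/-! ### § 1 The even power sums and the weights `(2, 4, 6, 8)` -/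

/-- The basic invariants `p₂, p₄, p₆, p₈` of `W(B₄)` as a family (`evenPsum k = p_{2(k+1)}`, the indexing of the
tree's `isSymmetric_and_forall_aeval_eq_iff_mem_adjoin_psum_even`). [cite: Humphreys1990, §3.7 Table 1 (B_n: 2, 4, …, 2n)] -/
def evenPsum (k : Fin 4) : MvPolynomial (Fin 4) ℝ := psum (Fin 4) ℝ (2 * ((k : ℕ) + 1))

/-- Unfolding lemma. [cite: Humphreys1990, §3.7 Table 1 (B_n)] -/
theorem evenPsum_apply (k : Fin 4) : evenPsum k = psum (Fin 4) ℝ (2 * ((k : ℕ) + 1)) := rfl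

/-- `evenPsum` is the tree's family `fun k => psum (Fin 4) ℝ (2 * (k + 1))`. [cite: Humphreys1990, §3.7 Table 1 (B_n)] -/
theorem evenPsum_eq : evenPsum = fun k : Fin 4 => psum (Fin 4) ℝ (2 * ((k : ℕ) + 1)) := rfl

/-- `p_{2(k+1)}` is homogeneous of degree `2(k+1)`. [cite: Humphreys1990, §3.7 Table 1 (B_n)] -/
theorem isHomogeneous_evenPsum (k : Fin 4) : (evenPsum k).IsHomogeneous (2 * ((k : ℕ) + 1)) :=
  psum_isHomogeneous _

/-- The weight of an exponent vector for the degrees `(2, 4, 6, 8)`, in coordinates.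
[cite: Humphreys1990, §3.7 ("dim of the space of invariants of degree a = number of monomials of weight a")] -/
theorem weight_eq (β : Fin 4 →₀ ℕ) :
    Finsupp.weight (fun k : Fin 4 => 2 * ((k : ℕ) + 1)) β = 2 * β 0 + 4 * β 1 + 6 * β 2 + 8 * β 3 := by
  rw [Finsupp.weight_apply, Finsupp.sum_fintype _ _ (fun i => by simp)]
  simp only [smul_eq_mul, Fin.sum_univ_four, Fin.isValue, Fin.val_zero, Fin.val_one, Fin.val_two]
  have h3 : ((3 : Fin 4) : ℕ) = 3 := rfl
  rw [h3]
  ring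

/-- Every weight is even (all the degrees `2, 4, 6, 8` are). [cite: Humphreys1990, §3.7 Table 1 (B_n)] -/
theorem even_weight (β : Fin 4 →₀ ℕ) : Even (Finsupp.weight (fun k : Fin 4 => 2 * ((k : ℕ) + 1)) β) := by
  rw [weight_eq]
  exact ⟨β 0 + 2 * β 1 + 3 * β 2 + 4 * β 3, by ring⟩

/-- The exponent vectors of weight `4`: `p₂²` and `p₄`. [cite: Humphreys1990, §3.7 Table 1] -/
theorem weight_eq_four {β : Fin 4 →₀ ℕ} (h : Finsupp.weight (fun k : Fin 4 => 2 * ((k : ℕ) + 1)) β = 4) :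
    (β 0 = 2 ∧ β 1 = 0 ∧ β 2 = 0 ∧ β 3 = 0) ∨ (β 0 = 0 ∧ β 1 = 1 ∧ β 2 = 0 ∧ β 3 = 0) := by
  rw [weight_eq] at h
  have h3 : β 3 = 0 := by omega
  have h2 : β 2 = 0 := by omega
  have h1 : β 1 ≤ 1 := by omega
  interval_cases h : β 1 <;> omega

/-- The exponent vectors of weight `6`: `p₂³`, `p₂p₄`, `p₆`. [cite: Humphreys1990, §3.7 Table 1] -/
theorem weight_eq_six {β : Fin 4 →₀ ℕ} (h : Finsupp.weight (fun k : Fin 4 => 2 * ((k : ℕ) + 1)) β = 6) :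
    (β 0 = 3 ∧ β 1 = 0 ∧ β 2 = 0 ∧ β 3 = 0) ∨ (β 0 = 1 ∧ β 1 = 1 ∧ β 2 = 0 ∧ β 3 = 0) ∨
      (β 0 = 0 ∧ β 1 = 0 ∧ β 2 = 1 ∧ β 3 = 0) := by
  rw [weight_eq] at h
  have h3 : β 3 = 0 := by omega
  have h2 : β 2 ≤ 1 := by omega
  have h1 : β 1 ≤ 1 := by omega
  interval_cases h : β 2 <;> interval_cases h' : β 1 <;> omega

/-- The exponent vectors of weight `10`: `p₄p₆`, `p₂p₈`, `p₂p₄²`, `p₂²p₆`, `p₂³p₄`, `p₂⁵`.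
[cite: Humphreys1990, §3.7 Table 1] -/
theorem weight_eq_ten {β : Fin 4 →₀ ℕ} (h : Finsupp.weight (fun k : Fin 4 => 2 * ((k : ℕ) + 1)) β = 10) :
    (β 0 = 0 ∧ β 1 = 1 ∧ β 2 = 1 ∧ β 3 = 0) ∨ (β 0 = 1 ∧ β 1 = 0 ∧ β 2 = 0 ∧ β 3 = 1) ∨
      (β 0 = 1 ∧ β 1 = 2 ∧ β 2 = 0 ∧ β 3 = 0) ∨ (β 0 = 2 ∧ β 1 = 0 ∧ β 2 = 1 ∧ β 3 = 0) ∨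
        (β 0 = 3 ∧ β 1 = 1 ∧ β 2 = 0 ∧ β 3 = 0) ∨ (β 0 = 5 ∧ β 1 = 0 ∧ β 2 = 0 ∧ β 3 = 0) := by
  rw [weight_eq] at h
  have h3 : β 3 ≤ 1 := by omega
  have h2 : β 2 ≤ 1 := by omega
  have h1 : β 1 ≤ 2 := by omega
  interval_cases h : β 3 <;> interval_cases h' : β 2 <;> interval_cases h'' : β 1 <;> omega

/-! ### § 2 Homogeneous elements of `ℝ[p₂, p₄, p₆, p₈]` of low degree -/

/-- `y^β ↦ p₂^{β₀} p₄^{β₁} p₆^{β₂} p₈^{β₃}` under the substitution `yₖ ↦ p_{2(k+1)}`.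
[cite: Humphreys1990, §3.7 (monomials in the basic invariants)] -/
theorem aeval_evenPsum_monomial (β : Fin 4 →₀ ℕ) (c : ℝ) :
    aeval evenPsum (monomial β c) =
      c • (evenPsum 0 ^ β 0 * evenPsum 1 ^ β 1 * evenPsum 2 ^ β 2 * evenPsum 3 ^ β 3) := by
  rw [aeval_monomial, Finsupp.prod_fintype _ _ (fun i => by rw [pow_zero]), Fin.prod_univ_four,
    Algebra.smul_def, algebraMap_eq]

/-- A symmetric, flip-invariant homogeneous polynomial of degree `a` is `q(p₂, p₄, p₆, p₈)` for an isobaric `q` of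
weight `a` (the tree's `𝒫^{B₄} = ℝ[p₂, …, p₈]` and its grading). [cite: Humphreys1990, §3.7 with §3.5] -/
theorem exists_isWeightedHomogeneous_of_invariant {g : MvPolynomial (Fin 4) ℝ} (hs : g.IsSymmetric)
    (hflip : ∀ i : Fin 4,
      aeval (fun j => (if j = i then (-1 : ℝ) else 1) • (X j : MvPolynomial (Fin 4) ℝ)) g = g)
    {a : ℕ} (hg : g.IsHomogeneous a) :
    ∃ q : MvPolynomial (Fin 4) ℝ, q.IsWeightedHomogeneous (fun k : Fin 4 => 2 * ((k : ℕ) + 1)) a ∧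
      aeval evenPsum q = g := by
  have hmem : g ∈ (aeval evenPsum : MvPolynomial (Fin 4) ℝ →ₐ[ℝ] MvPolynomial (Fin 4) ℝ).range := by
    rw [aeval_range, evenPsum_eq]
    exact mem_adjoin_psum_even_of_isSymmetric_of_forall_aeval_flip_eq hs hflip
  exact exists_isWeightedHomogeneous_aeval_eq (fun k => isHomogeneous_evenPsum k) hg hmem

/-- The expansion `g = Σ_β c_β p^β` over the support of an isobaric preimage. [cite: Humphreys1990, §3.7] -/
theorem eq_sum_support_of_aeval_eq {g q : MvPolynomial (Fin 4) ℝ} (hq : aeval evenPsum q = g) :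
    g = ∑ β ∈ q.support, coeff β q •
      (evenPsum 0 ^ β 0 * evenPsum 1 ^ β 1 * evenPsum 2 ^ β 2 * evenPsum 3 ^ β 3) := by
  rw [← hq]
  conv_lhs => rw [q.as_sum]
  rw [map_sum]
  exact Finset.sum_congr rfl fun β _ => aeval_evenPsum_monomial β _

/-- **There are no `W(B₄)`-invariants of odd degree** (all of `p₂, p₄, p₆, p₈` have even degree).
[cite: Humphreys1990, §3.7 Table 1 (B_n: all degrees even)] -/
theorem eq_zero_of_odd {g : MvPolynomial (Fin 4) ℝ} (hs : g.IsSymmetric)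
    (hflip : ∀ i : Fin 4,
      aeval (fun j => (if j = i then (-1 : ℝ) else 1) • (X j : MvPolynomial (Fin 4) ℝ)) g = g)
    {a : ℕ} (hg : g.IsHomogeneous a) (ha : Odd a) : g = 0 := by
  obtain ⟨q, hqw, hq⟩ := exists_isWeightedHomogeneous_of_invariant hs hflip hg
  have hq0 : q = 0 := by
    by_contra hne
    obtain ⟨β, hβ⟩ := MvPolynomial.ne_zero_iff.mp hne
    have hw := hqw hβ
    have hev := even_weight β
    rw [hw] at hev
    exact (Nat.not_even_iff_odd.mpr ha) hev
  rw [← hq, hq0, map_zero]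

/-- Degree `4`: a symmetric flip-invariant quartic lies in `span{p₄, p₂²}`. [cite: Humphreys1990, §3.7 Table 1] -/
theorem mem_span_weight_four {g : MvPolynomial (Fin 4) ℝ} (hs : g.IsSymmetric)
    (hflip : ∀ i : Fin 4,
      aeval (fun j => (if j = i then (-1 : ℝ) else 1) • (X j : MvPolynomial (Fin 4) ℝ)) g = g)
    (hg : g.IsHomogeneous 4) :
    ∃ c₁ c₂ : ℝ, g = c₁ • evenPsum 1 + c₂ • evenPsum 0 ^ 2 := by
  obtain ⟨q, hqw, hq⟩ := exists_isWeightedHomogeneous_of_invariant hs hflip hg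
  classical
  refine ⟨∑ β ∈ q.support, if β 1 = 1 then coeff β q else 0,
    ∑ β ∈ q.support, if β 0 = 2 then coeff β q else 0, ?_⟩
  rw [eq_sum_support_of_aeval_eq hq, Finset.sum_smul, Finset.sum_smul, ← Finset.sum_add_distrib]
  refine Finset.sum_congr rfl fun β hβ => ?_
  rcases weight_eq_four (hqw (mem_support_iff.mp hβ)) with ⟨h0, h1, h2, h3⟩ | ⟨h0, h1, h2, h3⟩
  · simp [h0, h1, h2, h3]
  · simp [h0, h1, h2, h3]

/-- Degree `6`: a symmetric flip-invariant sextic lies in `span{p₆, p₂p₄, p₂³}`. [cite: Humphreys1990, §3.7 Table 1] -/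
theorem mem_span_weight_six {g : MvPolynomial (Fin 4) ℝ} (hs : g.IsSymmetric)
    (hflip : ∀ i : Fin 4,
      aeval (fun j => (if j = i then (-1 : ℝ) else 1) • (X j : MvPolynomial (Fin 4) ℝ)) g = g)
    (hg : g.IsHomogeneous 6) :
    ∃ c₁ c₂ c₃ : ℝ, g = c₁ • evenPsum 2 + c₂ • (evenPsum 0 * evenPsum 1) + c₃ • evenPsum 0 ^ 3 := by
  obtain ⟨q, hqw, hq⟩ := exists_isWeightedHomogeneous_of_invariant hs hflip hg
  classical
  refine ⟨∑ β ∈ q.support, if β 2 = 1 then coeff β q else 0,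
    ∑ β ∈ q.support, if β 1 = 1 then coeff β q else 0,
    ∑ β ∈ q.support, if β 0 = 3 then coeff β q else 0, ?_⟩
  rw [eq_sum_support_of_aeval_eq hq, Finset.sum_smul, Finset.sum_smul, Finset.sum_smul,
    ← Finset.sum_add_distrib, ← Finset.sum_add_distrib]
  refine Finset.sum_congr rfl fun β hβ => ?_
  rcases weight_eq_six (hqw (mem_support_iff.mp hβ)) with ⟨h0, h1, h2, h3⟩ | ⟨h0, h1, h2, h3⟩ | ⟨h0, h1, h2, h3⟩
  · simp [h0, h1, h2, h3]
  · simp [h0, h1, h2, h3]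
  · simp [h0, h1, h2, h3]

/-- Degree `10`: a symmetric flip-invariant polynomial of degree `10` lies in
`span{p₄p₆, p₂p₈, p₂p₄², p₂²p₆, p₂³p₄, p₂⁵}`. [cite: Humphreys1990, §3.7 Table 1] -/
theorem mem_span_weight_ten {g : MvPolynomial (Fin 4) ℝ} (hs : g.IsSymmetric)
    (hflip : ∀ i : Fin 4,
      aeval (fun j => (if j = i then (-1 : ℝ) else 1) • (X j : MvPolynomial (Fin 4) ℝ)) g = g)
    (hg : g.IsHomogeneous 10) :
    ∃ c₁ c₂ c₃ c₄ c₅ c₆ : ℝ, g = c₁ • (evenPsum 1 * evenPsum 2) + c₂ • (evenPsum 0 * evenPsum 3) +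
      c₃ • (evenPsum 0 * evenPsum 1 ^ 2) + c₄ • (evenPsum 0 ^ 2 * evenPsum 2) +
        c₅ • (evenPsum 0 ^ 3 * evenPsum 1) + c₆ • evenPsum 0 ^ 5 := by
  obtain ⟨q, hqw, hq⟩ := exists_isWeightedHomogeneous_of_invariant hs hflip hg
  classical
  refine ⟨∑ β ∈ q.support, if β 0 = 0 then coeff β q else 0,
    ∑ β ∈ q.support, if β 3 = 1 then coeff β q else 0,
    ∑ β ∈ q.support, if β 1 = 2 then coeff β q else 0,
    ∑ β ∈ q.support, if β 0 = 2 then coeff β q else 0,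
    ∑ β ∈ q.support, if β 0 = 3 then coeff β q else 0,
    ∑ β ∈ q.support, if β 0 = 5 then coeff β q else 0, ?_⟩
  rw [eq_sum_support_of_aeval_eq hq]
  simp only [Finset.sum_smul, ← Finset.sum_add_distrib]
  refine Finset.sum_congr rfl fun β hβ => ?_
  rcases weight_eq_ten (hqw (mem_support_iff.mp hβ)) with
    ⟨h0, h1, h2, h3⟩ | ⟨h0, h1, h2, h3⟩ | ⟨h0, h1, h2, h3⟩ | ⟨h0, h1, h2, h3⟩ | ⟨h0, h1, h2, h3⟩ | ⟨h0, h1, h2, h3⟩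
  all_goals simp [h0, h1, h2, h3]

/-! ### § 3 The extra reflection `s : xⱼ ↦ xⱼ − ½ Σᵢ xᵢ` at three test points -/

/-- Point evaluation of `g ∘ s`: `(aeval s g)(x) = g(x − ½(Σx)(1,1,1,1))`. [cite: Humphreys1990, §2.10 (F₄)] -/
theorem eval_aeval_halfSum (x : Fin 4 → ℝ) (g : MvPolynomial (Fin 4) ℝ) :
    eval x (aeval (fun j => X j - C (1 / 2 : ℝ) * ∑ i, (X i : MvPolynomial (Fin 4) ℝ)) g) =
      eval (fun j => x j - (∑ i, x i) / 2) g := by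
  rw [aeval_eq_bind₁, eval, eval₂Hom_bind₁]
  change eval (fun j => eval x (X j - C (1 / 2 : ℝ) * ∑ i, (X i : MvPolynomial (Fin 4) ℝ))) g = _
  have : (fun j => eval x (X j - C (1 / 2 : ℝ) * ∑ i, (X i : MvPolynomial (Fin 4) ℝ))) =
      fun j => x j - (∑ i, x i) / 2 := funext fun j => by
    simp only [map_sub, map_mul, eval_X, eval_C, map_sum]; ring
  rw [this]

/-- `p₂ = Σ xᵢ²` is invariant under `s` (an orthogonal reflection). [cite: Humphreys1990, §2.10 (F₄) with §1.1 (s_α ∈ O(V))] -/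
theorem aeval_halfSum_psum_two :
    aeval (fun j => X j - C (1 / 2 : ℝ) * ∑ i, (X i : MvPolynomial (Fin 4) ℝ)) (psum (Fin 4) ℝ 2) =
      psum (Fin 4) ℝ 2 := by
  have h : C (1 / 2 : ℝ) * 2 = (1 : MvPolynomial (Fin 4) ℝ) := by
    rw [show (2 : MvPolynomial (Fin 4) ℝ) = C 2 from (map_ofNat C 2).symm, ← map_mul]
    norm_num
  simp only [psum, Fin.sum_univ_four, map_add, map_pow, aeval_X]
  linear_combination (2 * C (1 / 2 : ℝ) * (X 0 + X 1 + X 2 + X 3 : MvPolynomial (Fin 4) ℝ) ^ 2) * h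

/-- `s(1,0,0,0) = (½, −½, −½, −½)`. [cite: Humphreys1990, §2.10 (F₄)] -/
theorem halfSum_pt₁ :
    (fun j => (![1, 0, 0, 0] : Fin 4 → ℝ) j - (∑ i, (![1, 0, 0, 0] : Fin 4 → ℝ) i) / 2) =
      ![1 / 2, -1 / 2, -1 / 2, -1 / 2] := by
  funext j
  fin_cases j <;> simp [Fin.sum_univ_four] <;> norm_num

/-- `s(1,1,1,0) = (−½, −½, −½, −3/2)`. [cite: Humphreys1990, §2.10 (F₄)] -/
theorem halfSum_pt₂ :
    (fun j => (![1, 1, 1, 0] : Fin 4 → ℝ) j - (∑ i, (![1, 1, 1, 0] : Fin 4 → ℝ) i) / 2) =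
      ![-1 / 2, -1 / 2, -1 / 2, -3 / 2] := by
  funext j
  fin_cases j <;> simp [Fin.sum_univ_four] <;> norm_num

/-- `s(2,1,0,0) = (½, −½, −3/2, −3/2)`. [cite: Humphreys1990, §2.10 (F₄)] -/
theorem halfSum_pt₃ :
    (fun j => (![2, 1, 0, 0] : Fin 4 → ℝ) j - (∑ i, (![2, 1, 0, 0] : Fin 4 → ℝ) i) / 2) =
      ![1 / 2, -1 / 2, -3 / 2, -3 / 2] := by
  funext j
  fin_cases j <;> simp [Fin.sum_univ_four] <;> norm_num

/-- Entries of a literal vector of length four. [folklore] -/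
private theorem vec4_apply (a b c d : ℝ) :
    (![a, b, c, d] : Fin 4 → ℝ) 0 = a ∧ (![a, b, c, d] : Fin 4 → ℝ) 1 = b ∧
      (![a, b, c, d] : Fin 4 → ℝ) 2 = c ∧ (![a, b, c, d] : Fin 4 → ℝ) 3 = d :=
  ⟨rfl, rfl, rfl, rfl⟩

/-- Evaluating `p_{2(k+1)}` at a literal point. [cite: Humphreys1990, §3.7] -/
theorem eval_evenPsum_vec (a b c d : ℝ) (k : Fin 4) :
    eval ![a, b, c, d] (evenPsum k) =
      a ^ (2 * ((k : ℕ) + 1)) + b ^ (2 * ((k : ℕ) + 1)) + c ^ (2 * ((k : ℕ) + 1)) + d ^ (2 * ((k : ℕ) + 1)) := by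
  obtain ⟨h0, h1, h2, h3⟩ := vec4_apply a b c d
  simp only [evenPsum, psum, Fin.sum_univ_four, map_add, map_pow, eval_X, h0, h1, h2, h3]

/-- `(p₂, p₄, p₆, p₈)(1,0,0,0) = (1, 1, 1, 1)`. [cite: Humphreys1990, §3.7] -/
theorem eval_evenPsum_pt₁ :
    eval ![1, 0, 0, 0] (evenPsum 0) = 1 ∧ eval ![1, 0, 0, 0] (evenPsum 1) = 1 ∧
      eval ![1, 0, 0, 0] (evenPsum 2) = 1 ∧ eval ![1, 0, 0, 0] (evenPsum 3) = 1 := by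
  refine ⟨?_, ?_, ?_, ?_⟩ <;> norm_num [eval_evenPsum_vec]

/-- `(p₂, p₄, p₆, p₈)(½,−½,−½,−½) = (1, ¼, 1/16, 1/64)`. [cite: Humphreys1990, §3.7] -/
theorem eval_evenPsum_spt₁ :
    eval ![1 / 2, -1 / 2, -1 / 2, -1 / 2] (evenPsum 0) = 1 ∧ eval ![1 / 2, -1 / 2, -1 / 2, -1 / 2] (evenPsum 1) = 1 / 4 ∧
      eval ![1 / 2, -1 / 2, -1 / 2, -1 / 2] (evenPsum 2) = 1 / 16 ∧
        eval ![1 / 2, -1 / 2, -1 / 2, -1 / 2] (evenPsum 3) = 1 / 64 := by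
  refine ⟨?_, ?_, ?_, ?_⟩ <;> norm_num [eval_evenPsum_vec]

/-- `(p₂, p₄, p₆, p₈)(1,1,1,0) = (3, 3, 3, 3)`. [cite: Humphreys1990, §3.7] -/
theorem eval_evenPsum_pt₂ :
    eval ![1, 1, 1, 0] (evenPsum 0) = 3 ∧ eval ![1, 1, 1, 0] (evenPsum 1) = 3 ∧
      eval ![1, 1, 1, 0] (evenPsum 2) = 3 ∧ eval ![1, 1, 1, 0] (evenPsum 3) = 3 := by
  refine ⟨?_, ?_, ?_, ?_⟩ <;> norm_num [eval_evenPsum_vec]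

/-- `(p₂, p₄, p₆, p₈)(−½,−½,−½,−3/2) = (3, 21/4, 183/16, 1641/64)`. [cite: Humphreys1990, §3.7] -/
theorem eval_evenPsum_spt₂ :
    eval ![-1 / 2, -1 / 2, -1 / 2, -3 / 2] (evenPsum 0) = 3 ∧
      eval ![-1 / 2, -1 / 2, -1 / 2, -3 / 2] (evenPsum 1) = 21 / 4 ∧
        eval ![-1 / 2, -1 / 2, -1 / 2, -3 / 2] (evenPsum 2) = 183 / 16 ∧
          eval ![-1 / 2, -1 / 2, -1 / 2, -3 / 2] (evenPsum 3) = 1641 / 64 := by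
  refine ⟨?_, ?_, ?_, ?_⟩ <;> norm_num [eval_evenPsum_vec]

/-- `(p₂, p₄, p₆, p₈)(2,1,0,0) = (5, 17, 65, 257)`. [cite: Humphreys1990, §3.7] -/
theorem eval_evenPsum_pt₃ :
    eval ![2, 1, 0, 0] (evenPsum 0) = 5 ∧ eval ![2, 1, 0, 0] (evenPsum 1) = 17 ∧
      eval ![2, 1, 0, 0] (evenPsum 2) = 65 ∧ eval ![2, 1, 0, 0] (evenPsum 3) = 257 := by
  refine ⟨?_, ?_, ?_, ?_⟩ <;> norm_num [eval_evenPsum_vec]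

/-- `(p₂, p₄, p₆, p₈)(½,−½,−3/2,−3/2) = (5, 41/4, 365/16, 3281/64)`. [cite: Humphreys1990, §3.7] -/
theorem eval_evenPsum_spt₃ :
    eval ![1 / 2, -1 / 2, -3 / 2, -3 / 2] (evenPsum 0) = 5 ∧
      eval ![1 / 2, -1 / 2, -3 / 2, -3 / 2] (evenPsum 1) = 41 / 4 ∧
        eval ![1 / 2, -1 / 2, -3 / 2, -3 / 2] (evenPsum 2) = 365 / 16 ∧
          eval ![1 / 2, -1 / 2, -3 / 2, -3 / 2] (evenPsum 3) = 3281 / 64 := by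
  refine ⟨?_, ?_, ?_, ?_⟩ <;> norm_num [eval_evenPsum_vec]

/-! ### § 4 The cut by `s`-invariance in degrees `4`, `6`, `10` -/

/-- **Degree 4: a `W(F₄)`-invariant quartic is a multiple of `p₂²`** (no «anisotropic» invariant of degree 4:
`4` is not a degree of `F₄`). [cite: Humphreys1990, §3.7 Table 1 (F₄: 2, 6, 8, 12 — no 4)] -/
theorem mem_span_of_invariant_four {g : MvPolynomial (Fin 4) ℝ} (hs : g.IsSymmetric)
    (hflip : ∀ i : Fin 4,
      aeval (fun j => (if j = i then (-1 : ℝ) else 1) • (X j : MvPolynomial (Fin 4) ℝ)) g = g)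
    (hhalf : aeval (fun j => X j - C (1 / 2 : ℝ) * ∑ i, (X i : MvPolynomial (Fin 4) ℝ)) g = g)
    (hg : g.IsHomogeneous 4) :
    g ∈ Submodule.span ℝ (Set.range ![evenPsum 0 ^ 2]) := by
  obtain ⟨c₁, c₂, rfl⟩ := mem_span_weight_four hs hflip hg
  have key := congrArg (eval ![1, 0, 0, 0]) hhalf
  rw [eval_aeval_halfSum, halfSum_pt₁] at key
  obtain ⟨a0, a1, -, -⟩ := eval_evenPsum_pt₁
  obtain ⟨b0, b1, -, -⟩ := eval_evenPsum_spt₁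
  simp only [map_add, smul_eval, map_pow, a0, a1, b0, b1] at key
  have hc₁ : c₁ = 0 := by linarith
  subst hc₁
  rw [zero_smul, zero_add]
  exact Submodule.smul_mem _ _ (Submodule.subset_span ⟨0, rfl⟩)

/-- **Degree 6: a `W(F₄)`-invariant sextic lies in `span{p₂³, 5p₂p₄ − 4p₆}`** (so the degree-6 invariants have
dimension `≤ 2`). [cite: Humphreys1990, §3.7 Table 1 (F₄: one basic invariant of degree 6)] -/
theorem mem_span_of_invariant_six {g : MvPolynomial (Fin 4) ℝ} (hs : g.IsSymmetric)
    (hflip : ∀ i : Fin 4,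
      aeval (fun j => (if j = i then (-1 : ℝ) else 1) • (X j : MvPolynomial (Fin 4) ℝ)) g = g)
    (hhalf : aeval (fun j => X j - C (1 / 2 : ℝ) * ∑ i, (X i : MvPolynomial (Fin 4) ℝ)) g = g)
    (hg : g.IsHomogeneous 6) :
    g ∈ Submodule.span ℝ (Set.range
      ![evenPsum 0 ^ 3, (5 : ℝ) • (evenPsum 0 * evenPsum 1) - (4 : ℝ) • evenPsum 2]) := by
  obtain ⟨c₁, c₂, c₃, rfl⟩ := mem_span_weight_six hs hflip hg
  have key := congrArg (eval ![1, 0, 0, 0]) hhalf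
  rw [eval_aeval_halfSum, halfSum_pt₁] at key
  obtain ⟨a0, a1, a2, -⟩ := eval_evenPsum_pt₁
  obtain ⟨b0, b1, b2, -⟩ := eval_evenPsum_spt₁
  simp only [map_add, smul_eval, map_pow, map_mul, a0, a1, a2, b0, b1, b2] at key
  -- `key : c₁/16 + c₂/4 + c₃ = c₁ + c₂ + c₃`, i.e. `c₁ = −(4/5) c₂`
  have hc₁ : c₁ = -(4 / 5) * c₂ := by linarith
  subst hc₁
  rw [Submodule.mem_span_range_iff_exists_fun]
  refine ⟨![c₃, c₂ / 5], ?_⟩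
  rw [Fin.sum_univ_two]
  simp only [Matrix.cons_val_zero, Matrix.cons_val_one, smul_sub, smul_smul]
  module

/-- **Degree 10: a `W(F₄)`-invariant of degree 10 lies in the span of `p₂⁵`,
`35p₂p₄² + 28p₂²p₆ − 60p₂p₈` and `7p₂p₄² + 7p₂³p₄ − 12p₂p₈`** (so dimension `≤ 3`; three test points).
[cite: Humphreys1990, §3.7 Table 1 (F₄: 10 = 2·5 = 2·2+6 = 2+8, three ways)] -/
theorem mem_span_of_invariant_ten {g : MvPolynomial (Fin 4) ℝ} (hs : g.IsSymmetric)
    (hflip : ∀ i : Fin 4,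
      aeval (fun j => (if j = i then (-1 : ℝ) else 1) • (X j : MvPolynomial (Fin 4) ℝ)) g = g)
    (hhalf : aeval (fun j => X j - C (1 / 2 : ℝ) * ∑ i, (X i : MvPolynomial (Fin 4) ℝ)) g = g)
    (hg : g.IsHomogeneous 10) :
    g ∈ Submodule.span ℝ (Set.range
      ![evenPsum 0 ^ 5,
        (35 : ℝ) • (evenPsum 0 * evenPsum 1 ^ 2) + (28 : ℝ) • (evenPsum 0 ^ 2 * evenPsum 2) -
          (60 : ℝ) • (evenPsum 0 * evenPsum 3),
        (7 : ℝ) • (evenPsum 0 * evenPsum 1 ^ 2) + (7 : ℝ) • (evenPsum 0 ^ 3 * evenPsum 1) -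
          (12 : ℝ) • (evenPsum 0 * evenPsum 3)]) := by
  obtain ⟨c₁, c₂, c₃, c₄, c₅, c₆, rfl⟩ := mem_span_weight_ten hs hflip hg
  have key₁ := congrArg (eval ![1, 0, 0, 0]) hhalf
  have key₂ := congrArg (eval ![1, 1, 1, 0]) hhalf
  have key₃ := congrArg (eval ![2, 1, 0, 0]) hhalf
  rw [eval_aeval_halfSum, halfSum_pt₁] at key₁
  rw [eval_aeval_halfSum, halfSum_pt₂] at key₂
  rw [eval_aeval_halfSum, halfSum_pt₃] at key₃
  obtain ⟨a0, a1, a2, a3⟩ := eval_evenPsum_pt₁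
  obtain ⟨b0, b1, b2, b3⟩ := eval_evenPsum_spt₁
  obtain ⟨a0', a1', a2', a3'⟩ := eval_evenPsum_pt₂
  obtain ⟨b0', b1', b2', b3'⟩ := eval_evenPsum_spt₂
  obtain ⟨a0'', a1'', a2'', a3''⟩ := eval_evenPsum_pt₃
  obtain ⟨b0'', b1'', b2'', b3''⟩ := eval_evenPsum_spt₃
  simp only [map_add, smul_eval, map_pow, map_mul, a0, a1, a2, a3, b0, b1, b2, b3] at key₁
  simp only [map_add, smul_eval, map_pow, map_mul, a0', a1', a2', a3', b0', b1', b2', b3'] at key₂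
  simp only [map_add, smul_eval, map_pow, map_mul, a0'', a1'', a2'', a3'', b0'', b1'', b2'', b3''] at key₃
  have hc₁ : c₁ = 0 := by linarith
  have hc₂ : c₂ = -(15 / 7) * c₄ - (12 / 7) * c₅ := by linarith
  have hc₃ : c₃ = (5 / 4) * c₄ + c₅ := by linarith
  subst hc₁ hc₂ hc₃
  rw [Submodule.mem_span_range_iff_exists_fun]
  refine ⟨![c₆, c₄ / 28, c₅ / 7], ?_⟩
  rw [Fin.sum_univ_three]
  simp only [Matrix.cons_val_zero, Matrix.cons_val_one, Matrix.cons_val_two, Matrix.head_cons,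
    Matrix.tail_cons, smul_add, smul_sub, smul_smul]
  module

/-! ### § 5 The numerical pin: `{dᵢ} = {2, 6, 8, 12}`

For positive even "degrees" `d₀, …, d₃` with `∏ dᵢ ≤ 1152`, one of them `2`, and at most `1`, `2`, `3` exponent
vectors of `d`-weight `4`, `6`, `10` respectively, the `dᵢ` are `2, 6, 8, 12` — the arithmetic that turns the
dimension bounds of § 4 and `|W(F₄)| ≤ 1152` into Table 1's row. -/

/-- Exponent vectors of a given `d`-weight form a finite set when all `dᵢ > 0` (`βᵢ ≤ βᵢ dᵢ ≤ a`).
[cite: Humphreys1990, §3.7 (finitely many monomials of each degree)] -/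
theorem finite_weight_eq {d : Fin 4 → ℕ} (hpos : ∀ i, 0 < d i) (a : ℕ) :
    Finite {β : Fin 4 →₀ ℕ // Finsupp.weight d β = a} := by
  refine Finite.of_injective (fun β : {β : Fin 4 →₀ ℕ // Finsupp.weight d β = a} =>
    fun i : Fin 4 => (⟨β.1 i, Nat.lt_succ_of_le
      ((Finsupp.le_weight d (Nat.pos_iff_ne_zero.mp (hpos i)) β.1).trans_eq β.2)⟩ : Fin (a + 1))) ?_
  · intro β β' h
    apply Subtype.ext
    ext i
    have := congrFun h i
    simp only [Fin.mk.injEq] at this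
    exact this

/-- Three pairwise distinct values give an injection from `Fin 3`. [folklore] -/
private theorem injective_vec3 {α : Type*} {x y z : α} (hxy : x ≠ y) (hxz : x ≠ z) (hyz : y ≠ z) :
    Function.Injective ![x, y, z] := by
  intro p q h
  fin_cases p <;> fin_cases q <;> simp_all [eq_comm]

/-- Four pairwise distinct values give an injection from `Fin 4`. [folklore] -/
private theorem injective_vec4 {α : Type*} {x y z w : α} (hxy : x ≠ y) (hxz : x ≠ z) (hxw : x ≠ w)
    (hyz : y ≠ z) (hyw : y ≠ w) (hzw : z ≠ w) : Function.Injective ![x, y, z, w] := by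
  intro p q h
  fin_cases p <;> fin_cases q <;> simp_all [eq_comm]

/-- The finite arithmetic at the end: three even numbers in `[6, 16]`, at most one of them `6`, not all `≤ 10`,
with product `≤ 576`, are `6, 8, 12`. [cite: Humphreys1990, §3.7 Table 1 (F₄: 2, 6, 8, 12) with §2.12 (|W| = 1152 = 2·6·8·12)] -/
theorem six_eight_twelve_of_bounds :
    ∀ a b c : Fin 17, (Even (a : ℕ) ∧ Even (b : ℕ) ∧ Even (c : ℕ) ∧ 6 ≤ (a : ℕ) ∧ 6 ≤ (b : ℕ) ∧
      6 ≤ (c : ℕ) ∧ ¬((a : ℕ) = 6 ∧ (b : ℕ) = 6) ∧ ¬((a : ℕ) = 6 ∧ (c : ℕ) = 6) ∧ ¬((b : ℕ) = 6 ∧ (c : ℕ) = 6) ∧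
        ¬((a : ℕ) ≤ 10 ∧ (b : ℕ) ≤ 10 ∧ (c : ℕ) ≤ 10) ∧ (a : ℕ) * b * c ≤ 576) →
          ((a : ℕ) = 6 ∨ (b : ℕ) = 6 ∨ (c : ℕ) = 6) ∧ ((a : ℕ) = 8 ∨ (b : ℕ) = 8 ∨ (c : ℕ) = 8) ∧
            ((a : ℕ) = 12 ∨ (b : ℕ) = 12 ∨ (c : ℕ) = 12) := by
  decide +kernel

/-- **The pin.** For positive even `d : Fin 4 → ℕ` with some `dᵢ = 2`, `∏ dᵢ ≤ 1152`, and at most `1`, `2`, `3`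
exponent vectors of `d`-weight `4`, `6`, `10`: `d` is a permutation of `(2, 6, 8, 12)`.
[cite: Humphreys1990, §3.7 Table 1 (F₄: 2, 6, 8, 12) with §3.9 Theorem (∏ dᵢ = |W|) and §2.12 (|W(F₄)| = 1152)] -/
theorem exists_perm_eq_of_bounds {d : Fin 4 → ℕ} (hpos : ∀ i, 0 < d i) (heven : ∀ i, Even (d i))
    (h2 : ∃ i, d i = 2)
    (h4 : Nat.card {β : Fin 4 →₀ ℕ // Finsupp.weight d β = 4} ≤ 1)
    (h6 : Nat.card {β : Fin 4 →₀ ℕ // Finsupp.weight d β = 6} ≤ 2)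
    (h10 : Nat.card {β : Fin 4 →₀ ℕ // Finsupp.weight d β = 10} ≤ 3)
    (hprod : ∏ i, d i ≤ 1152) :
    ∃ σ : Equiv.Perm (Fin 4), ∀ k, d (σ k) = (![2, 6, 8, 12] : Fin 4 → ℕ) k := by
  classical
  haveI := finite_weight_eq hpos 4
  haveI := finite_weight_eq hpos 6
  haveI := finite_weight_eq hpos 10
  obtain ⟨i₀, hi₀⟩ := h2
  -- weights of the test exponent vectors
  have wsingle : ∀ (i : Fin 4) (m : ℕ), Finsupp.weight d (Finsupp.single i m) = m * d i := fun i m => by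
    rw [Finsupp.weight_single, smul_eq_mul]
  have wadd : ∀ (i j : Fin 4) (m : ℕ), Finsupp.weight d (Finsupp.single i m + Finsupp.single j 1) =
      m * d i + d j := fun i j m => by
    rw [map_add, wsingle, wsingle, one_mul]
  -- (1) the other three degrees are ≥ 6
  have hne2 : ∀ j, j ≠ i₀ → d j ≠ 2 := by
    intro j hj hdj
    have hinj : Function.Injective
        (![⟨Finsupp.single i₀ 2, by rw [wsingle, hi₀]⟩, ⟨Finsupp.single i₀ 1 + Finsupp.single j 1, by
          rw [wadd, hi₀, hdj]⟩] : Fin 2 → {β : Fin 4 →₀ ℕ // Finsupp.weight d β = 4}) := by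
      intro p q h
      fin_cases p <;> fin_cases q
      · rfl
      · exfalso
        have := congrArg (fun β : {β : Fin 4 →₀ ℕ // Finsupp.weight d β = 4} => β.1 j) h
        simp [hj] at this
      · exfalso
        have := congrArg (fun β : {β : Fin 4 →₀ ℕ // Finsupp.weight d β = 4} => β.1 j) h
        simp [hj] at this
      · rfl
    have := Nat.card_le_card_of_injective _ hinj
    simp only [Nat.card_eq_fintype_card, Fintype.card_fin] at this
    omega
  have hne4 : ∀ j, j ≠ i₀ → d j ≠ 4 := by
    intro j hj hdj
    have hinj : Function.Injective
        (![⟨Finsupp.single i₀ 2, by rw [wsingle, hi₀]⟩, ⟨Finsupp.single j 1, by rw [wsingle, hdj]⟩] :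
          Fin 2 → {β : Fin 4 →₀ ℕ // Finsupp.weight d β = 4}) := by
      intro p q h
      fin_cases p <;> fin_cases q
      · rfl
      · exfalso
        have := congrArg (fun β : {β : Fin 4 →₀ ℕ // Finsupp.weight d β = 4} => β.1 j) h
        simp [hj] at this
      · exfalso
        have := congrArg (fun β : {β : Fin 4 →₀ ℕ // Finsupp.weight d β = 4} => β.1 j) h
        simp [hj] at this
      · rfl
    have := Nat.card_le_card_of_injective _ hinj
    simp only [Nat.card_eq_fintype_card, Fintype.card_fin] at this
    omega
  have hge6 : ∀ j, j ≠ i₀ → 6 ≤ d j := by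
    intro j hj
    have h1 := hpos j
    have h2 := hne2 j hj
    have h3 := hne4 j hj
    obtain ⟨r, hr⟩ := heven j
    omega
  -- the three other degrees
  set a : Fin 3 → ℕ := fun k => d (i₀.succAbove k) with ha
  have hsA : ∀ k, i₀.succAbove k ≠ i₀ := fun k => Fin.succAbove_ne i₀ k
  have hage : ∀ k, 6 ≤ a k := fun k => hge6 _ (hsA k)
  have haeven : ∀ k, Even (a k) := fun k => heven _
  -- (2) product bound: a₀ a₁ a₂ ≤ 576, hence each ≤ 16
  have hprod' : a 0 * a 1 * a 2 ≤ 576 := by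
    rw [Fin.prod_univ_succAbove _ i₀, hi₀, Fin.prod_univ_three] at hprod
    simp only [ha]
    linarith
  have hale : ∀ k, a k < 17 := by
    have h0 := hage 0; have h1 := hage 1; have h2 := hage 2
    intro k
    fin_cases k
    · show a 0 < 17; nlinarith [Nat.mul_le_mul h1 h2]
    · show a 1 < 17; nlinarith [Nat.mul_le_mul h0 h2]
    · show a 2 < 17; nlinarith [Nat.mul_le_mul h0 h1]
  -- (3) at most one of them is 6
  have hsix : ∀ k k', k ≠ k' → ¬(a k = 6 ∧ a k' = 6) := by
    rintro k k' hkk' ⟨hk, hk'⟩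
    have hjj' : i₀.succAbove k ≠ i₀.succAbove k' := fun h => hkk' (Fin.succAbove_right_injective h)
    have hinj : Function.Injective
        (![⟨Finsupp.single i₀ 3, by rw [wsingle, hi₀]⟩,
           ⟨Finsupp.single (i₀.succAbove k) 1, by rw [wsingle]; simp only [ha] at hk; omega⟩,
           ⟨Finsupp.single (i₀.succAbove k') 1, by rw [wsingle]; simp only [ha] at hk'; omega⟩] :
          Fin 3 → {β : Fin 4 →₀ ℕ // Finsupp.weight d β = 6}) := by
      refine injective_vec3 ?_ ?_ ?_
      · intro h
        have := congrArg (fun β : {β : Fin 4 →₀ ℕ // Finsupp.weight d β = 6} => β.1 (i₀.succAbove k)) h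
        simp [hsA k] at this
      · intro h
        have := congrArg (fun β : {β : Fin 4 →₀ ℕ // Finsupp.weight d β = 6} => β.1 (i₀.succAbove k')) h
        simp [hsA k'] at this
      · intro h
        have := congrArg (fun β : {β : Fin 4 →₀ ℕ // Finsupp.weight d β = 6} => β.1 (i₀.succAbove k')) h
        simp [hjj'.symm] at this
    have := Nat.card_le_card_of_injective _ hinj
    simp only [Nat.card_eq_fintype_card, Fintype.card_fin] at this
    omega
  -- (4) not all three are ≤ 10
  have hten : ¬(a 0 ≤ 10 ∧ a 1 ≤ 10 ∧ a 2 ≤ 10) := by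
    rintro ⟨h0, h1, h2⟩
    -- `βₖ = ((10 − aₖ)/2) e_{i₀} + e_{jₖ}` has weight 10
    have hβ : ∀ k, a k ≤ 10 →
        Finsupp.weight d (Finsupp.single i₀ ((10 - a k) / 2) + Finsupp.single (i₀.succAbove k) 1) = 10 := by
      intro k hk
      rw [wadd, hi₀]
      obtain ⟨r, hr⟩ := haeven k
      simp only [ha] at hk hr ⊢
      omega
    have hinj : Function.Injective
        (![⟨Finsupp.single i₀ 5, by rw [wsingle, hi₀]⟩,
           ⟨_, hβ 0 h0⟩, ⟨_, hβ 1 h1⟩, ⟨_, hβ 2 h2⟩] : Fin 4 → {β : Fin 4 →₀ ℕ // Finsupp.weight d β = 10}) := by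
      have h01 : i₀.succAbove 0 ≠ i₀.succAbove 1 := fun h => by
        have := Fin.succAbove_right_injective h; exact absurd this (by decide)
      have h02 : i₀.succAbove 0 ≠ i₀.succAbove 2 := fun h => by
        have := Fin.succAbove_right_injective h; exact absurd this (by decide)
      have h12 : i₀.succAbove 1 ≠ i₀.succAbove 2 := fun h => by
        have := Fin.succAbove_right_injective h; exact absurd this (by decide)
      refine injective_vec4 ?_ ?_ ?_ ?_ ?_ ?_
      · intro h
        have := congrArg (fun β : {β : Fin 4 →₀ ℕ // Finsupp.weight d β = 10} => β.1 (i₀.succAbove 0)) h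
        simp [hsA 0] at this
      · intro h
        have := congrArg (fun β : {β : Fin 4 →₀ ℕ // Finsupp.weight d β = 10} => β.1 (i₀.succAbove 1)) h
        simp [hsA 1] at this
      · intro h
        have := congrArg (fun β : {β : Fin 4 →₀ ℕ // Finsupp.weight d β = 10} => β.1 (i₀.succAbove 2)) h
        simp [hsA 2] at this
      · intro h
        have := congrArg (fun β : {β : Fin 4 →₀ ℕ // Finsupp.weight d β = 10} => β.1 (i₀.succAbove 1)) h
        simp [hsA 1] at this
      · intro h
        have := congrArg (fun β : {β : Fin 4 →₀ ℕ // Finsupp.weight d β = 10} => β.1 (i₀.succAbove 2)) h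
        simp [hsA 2] at this
      · intro h
        have := congrArg (fun β : {β : Fin 4 →₀ ℕ // Finsupp.weight d β = 10} => β.1 (i₀.succAbove 2)) h
        simp [hsA 2] at this
    have := Nat.card_le_card_of_injective _ hinj
    simp only [Nat.card_eq_fintype_card, Fintype.card_fin] at this
    omega
  -- (5) the arithmetic
  obtain ⟨hk6, hk8, hk12⟩ := six_eight_twelve_of_bounds ⟨a 0, hale 0⟩ ⟨a 1, hale 1⟩ ⟨a 2, hale 2⟩
    ⟨haeven 0, haeven 1, haeven 2, hage 0, hage 1, hage 2,
      hsix 0 1 (by decide), hsix 0 2 (by decide), hsix 1 2 (by decide), hten, hprod'⟩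
  -- indices carrying the degrees 6, 8, 12
  have hex : ∀ v : ℕ, (a 0 = v ∨ a 1 = v ∨ a 2 = v) → ∃ j, d j = v := by
    rintro v (h | h | h)
    · exact ⟨_, h⟩
    · exact ⟨_, h⟩
    · exact ⟨_, h⟩
  obtain ⟨j₆, hj₆⟩ := hex 6 hk6
  obtain ⟨j₈, hj₈⟩ := hex 8 hk8
  obtain ⟨j₁₂, hj₁₂⟩ := hex 12 hk12
  have hinj : Function.Injective ![i₀, j₆, j₈, j₁₂] := by
    refine injective_vec4 ?_ ?_ ?_ ?_ ?_ ?_ <;> intro h <;> [skip; skip; skip; skip; skip; skip] <;>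
      first
        | exact absurd (hi₀.symm.trans ((congrArg d h).trans hj₆)) (by decide)
        | exact absurd (hi₀.symm.trans ((congrArg d h).trans hj₈)) (by decide)
        | exact absurd (hi₀.symm.trans ((congrArg d h).trans hj₁₂)) (by decide)
        | exact absurd (hj₆.symm.trans ((congrArg d h).trans hj₈)) (by decide)
        | exact absurd (hj₆.symm.trans ((congrArg d h).trans hj₁₂)) (by decide)
        | exact absurd (hj₈.symm.trans ((congrArg d h).trans hj₁₂)) (by decide)
  refine ⟨Equiv.ofBijective _ (Finite.injective_iff_bijective.mp hinj), fun k => ?_⟩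
  rw [Equiv.ofBijective_apply]
  fin_cases k
  · exact hi₀
  · exact hj₆
  · exact hj₈
  · exact hj₁₂

end

end Literature.RepresentationTheory.ClassicalInvariants.WeylGroupF4
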